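import Mathlib
import Summits.ResolutionOfSingularities.ResolutionOfSingularities.Theorems.RadicialJungCleanModelsCleanLU3ArcTools
import Summits.ResolutionOfSingularities.ResolutionOfSingularities.Theorems.ValuativeLuAlphaPTorsorTowerModel
import Literature.AlgebraicGeometry.Resolution.QuadraticTransformsRegular
import Literature.AlgebraicGeometry.Resolution.QuadraticSequenceDimOneExistence
import Literature.AlgebraicGeometry.Resolution.ArithmeticalThreefolds
import Literature.AlgebraicGeometry.Resolution.AffineDomainDimension
import Literature.RingTheory.KrullDimension.AffineCatenary
import Literature.RingTheory.KrullDimension.AffineDimension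
import HarnessLib

/-!
# Route `RadicialJung`, crux `CleanModels` (stmt-15917), stub `stub_cleanLU3Defect`, class (A) «arcs»: the quadratic
# sequence PACKAGE — steps, regularity, finitely generated models, dimension three, transport of a derivation

Line `Sketch` rev 19 of crux stmt-ResolutionOfSingularities-15917; lead `res-B-lead-1` g3.  OURS; nothing here proves
resolution in characteristic `p`.

For the wrapper around `arc_core` (`…CleanLU3ArcCore.lean`, ✓ p681465) one needs, along the sequence `R₀ → R₁ → ⋯` of
quadratic transforms of `R₀ = locAtCentre A O` along a ZERO-DIMENSIONAL valuation ring `O ⊇ A` (every centre above `A`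
a closed point):

* `ringKrullDim_locAtCentre_eq_of_isMaximal` — for a finitely generated `k`-subalgebra `T ⊆ O` of `K` on which the
  centre of `O` is maximal, `dim (locAtCentre T O) = dim T` (affine dimension formula `dim T/𝔮 + ht 𝔮 = dim T`);
  `ringKrullDim_eq_of_fg_of_le` — two finitely generated models `A ≤ T` of `K` have the same dimension (`= tr.deg`).
* `exists_quadraticSeq_package` — the sequence exists, every member is a regular local ring, is
  `locAtCentre A' O` for a finitely generated `A ≤ A' ⊆ O`, and has dimension `dim (locAtCentre A O)`.
* `exists_derivation_preserving_seq` — a derivation `D` of `K` with `s • D` preserving `A` (`s ≠ 0`) has, at every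
  stage `i`, a nonzero multiple `sᵢ • D` preserving `Rᵢ` (`x · E` preserves `R[𝔪/x]`, ✓ `mul_derivation_mem_blowupRing`).
-/

noncomputable section

set_option linter.dupNamespace false -- mandated namespace of this single-conjunct summit

open IsLocalRing
open Literature.AlgebraicGeometry.Resolution

namespace Summit.ResolutionOfSingularities.ResolutionOfSingularities.Theorems.RadicialJung.CleanModels

variable {k K : Type} [Field k] [Field K] [Algebra k K]

/-! ## Local rings of `K` -/

/-- `locAtCentre A O` is a local ring OF `K` (every element of `K` is a fraction of two of its elements) when
`Frac A = K`. [folklore] -/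
theorem isLocalRingOf_locAtCentre (A : Subalgebra k K) (O : ValuationSubring K) (hAO : A.toSubring ≤ O.toSubring)
    [IsFractionRing A K] : IsLocalRingOf (locAtCentre A.toSubring O) := by
  haveI := isLocalRing_locAtCentre hAO
  refine ⟨‹_›, fun z => ?_⟩
  obtain ⟨a, b, hb, rfl⟩ := IsFractionRing.div_surjective (A := A) z
  refine ⟨a, le_locAtCentre _ O a.2, b, le_locAtCentre _ O b.2, ?_, rfl⟩
  intro h0
  exact nonZeroDivisors.ne_zero hb (Subtype.ext h0)

/-! ## Dimension of the local rings of finitely generated models at closed centres -/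

/-- The subalgebra generated by `A` and a set `t`, as a `k`-subalgebra whose underlying subring is
`Subring.closure (A ∪ t)`. [folklore] -/
theorem exists_subalgebra_closure (A : Subalgebra k K) (t : Finset K) :
    ∃ A' : Subalgebra k K, A'.toSubring = Subring.closure ((A.toSubring : Set K) ∪ ↑t) ∧ A ≤ A' ∧
      (A.FG → A'.FG) := by
  classical
  let A' : Subalgebra k K :=
    { Subring.closure ((A.toSubring : Set K) ∪ ↑t) with
      algebraMap_mem' := fun r => Subring.subset_closure (Or.inl (A.algebraMap_mem r)) }
  have hA'sub : A'.toSubring = Subring.closure ((A.toSubring : Set K) ∪ ↑t) := rfl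
  have hAA' : A ≤ A' := fun w hw => Subring.subset_closure (Or.inl hw)
  refine ⟨A', hA'sub, hAA', fun ⟨s₀, hs₀⟩ => ?_⟩
  refine ⟨s₀ ∪ t, le_antisymm ?_ ?_⟩
  · rw [Algebra.adjoin_le_iff]
    rintro w hw
    rw [Finset.coe_union] at hw
    rcases hw with hw | hw
    · exact hAA' (hs₀ ▸ Algebra.subset_adjoin hw)
    · exact Subring.subset_closure (Or.inr hw)
  · intro w hw
    change w ∈ Subring.closure ((A.toSubring : Set K) ∪ ↑t) at hw
    have hle : Subring.closure ((A.toSubring : Set K) ∪ ↑t) ≤ (Algebra.adjoin k (↑(s₀ ∪ t) : Set K)).toSubring := by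
      rw [Subring.closure_le]
      rintro v (hv | hv)
      · have : v ∈ Algebra.adjoin k (s₀ : Set K) := by rw [hs₀]; exact hv
        exact Algebra.adjoin_mono (by rw [Finset.coe_union]; exact Set.subset_union_left) this
      · exact Algebra.subset_adjoin (by rw [Finset.coe_union]; exact Or.inr hv)
    exact hle hw

/-- **Two finitely generated models of `K/k` have the same Krull dimension** (both equal `tr.deg_k K`,
Matsumura Thm. 5.6). [cite: Matsumura1987, Thm. 5.6] -/
theorem ringKrullDim_eq_of_fg_of_le {A T : Subalgebra k K} (hAfg : A.FG) (hTfg : T.FG) (hAT : A ≤ T)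
    [IsFractionRing A K] : ringKrullDim T = ringKrullDim A := by
  haveI : Algebra.FiniteType k A := A.fg_iff_finiteType.mp hAfg
  haveI : Algebra.FiniteType k T := T.fg_iff_finiteType.mp hTfg
  haveI : IsFractionRing T K := isFractionRing_of_le hAT inferInstance
  rw [Literature.RingTheory.KrullDimension.ringKrullDim_eq_trdeg k T,
    Literature.RingTheory.KrullDimension.ringKrullDim_eq_trdeg k A,
    ← trdeg_eq_trdeg_of_isFractionRing T, ← trdeg_eq_trdeg_of_isFractionRing A]

/-- **The local ring of a finitely generated model at a CLOSED centre has the dimension of the model**: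
`dim (locAtCentre T O) = ht 𝔮 = dim T` for `𝔮 = 𝔪_O ∩ T` maximal (affine dimension formula `dim T/𝔮 + ht 𝔮 = dim T`).
[cite: Matsumura1987, Thm. 5.6] -/
theorem ringKrullDim_locAtCentre_eq_of_isMaximal (T : Subalgebra k K) (hTfg : T.FG) (O : ValuationSubring K)
    (hTO : T.toSubring ≤ O.toSubring) (hmax : (subringCentre T.toSubring O hTO).IsMaximal) :
    ringKrullDim (locAtCentre T.toSubring O) = ringKrullDim T := by
  letI : Algebra k T.toSubring := inferInstanceAs (Algebra k T)
  haveI : Algebra.FiniteType k T.toSubring := (T.fg_iff_finiteType.mp hTfg : Algebra.FiniteType k T)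
  haveI := isLocalization_locAtCentre (K := K) (O := O) hTO
  set 𝔮 := subringCentre T.toSubring O hTO with h𝔮
  have h1 : ringKrullDim (locAtCentre T.toSubring O) = 𝔮.height :=
    IsLocalization.AtPrime.ringKrullDim_eq_height 𝔮 (locAtCentre T.toSubring O)
  have h2 := Literature.RingTheory.KrullDimension.ringKrullDim_quotient_add_height k (A := T.toSubring) 𝔮
  have h0 : ringKrullDim (T.toSubring ⧸ 𝔮) = 0 :=
    ringKrullDim_eq_zero_of_isField ((Ideal.Quotient.maximal_ideal_iff_isField_quotient 𝔮).mp hmax)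
  rw [h0, zero_add] at h2
  rw [h1]
  exact h2

/-! ## The quadratic sequence package -/

/-- One local blowing up keeps «being `locAtCentre` of a finitely generated model above `A`». [folklore] -/
theorem exists_model_of_isLocalBlowup {A : Subalgebra k K} {O : ValuationSubring K}
    {A₁ : Subalgebra k K} (hAA₁ : A ≤ A₁) (hA₁fg : A₁.FG) {B' : Subring K}
    (h : IsLocalBlowup O (locAtCentre A₁.toSubring O) B') :
    ∃ A' : Subalgebra k K, A'.toSubring ≤ O.toSubring ∧ A ≤ A' ∧ A'.FG ∧ B' = locAtCentre A'.toSubring O := by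
  obtain ⟨hBO, t, htO, rfl⟩ := h
  obtain ⟨A', hA'sub, hA₁A', hfg⟩ := exists_subalgebra_closure A₁ t
  refine ⟨A', ?_, hAA₁.trans hA₁A', hfg hA₁fg, ?_⟩
  · rw [hA'sub, Subring.closure_le]
    rintro w (hw | hw)
    · exact (le_locAtCentre A₁.toSubring O).trans hBO hw
    · exact htO hw
  · rw [PfaffLine.locAtCentre_closure_locAtCentre_union, hA'sub]

/-- **Extended version of `exists_model_of_isLocalBlowup`** returning `A₁ ≤ A'` alongside `A ≤ A'`.
One local blowing up keeps «being `locAtCentre` of a finitely generated model above `A`», AND the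
input model `A₁` is contained in the output model `A'`. [folklore] -/
theorem exists_model_of_isLocalBlowup_with_input_le {A : Subalgebra k K} {O : ValuationSubring K}
    {A₁ : Subalgebra k K} (hAA₁ : A ≤ A₁) (hA₁fg : A₁.FG) {B' : Subring K}
    (h : IsLocalBlowup O (locAtCentre A₁.toSubring O) B') :
    ∃ A' : Subalgebra k K, A'.toSubring ≤ O.toSubring ∧ A ≤ A' ∧ A₁ ≤ A' ∧ A'.FG ∧ B' = locAtCentre A'.toSubring O := by
  obtain ⟨hBO, t, htO, rfl⟩ := h
  obtain ⟨A', hA'sub, hA₁A', hfg⟩ := exists_subalgebra_closure A₁ t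
  -- hA₁A' : A₁ ≤ A' is the key fact we're exposing
  refine ⟨A', ?_, hAA₁.trans hA₁A', hA₁A', hfg hA₁fg, ?_⟩
  · rw [hA'sub, Subring.closure_le]
    rintro w (hw | hw)
    · exact (le_locAtCentre A₁.toSubring O).trans hBO hw
    · exact htO hw
  · rw [PfaffLine.locAtCentre_closure_locAtCentre_union, hA'sub]

/-- **The quadratic sequence package.** Let `A` be a finitely generated `k`-subalgebra of `K` with `Frac A = K` inside
the valuation ring `O`, with `R₀ = locAtCentre A O` regular, and let `O` be ZERO-DIMENSIONAL above `A` (the centre of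
`O` on every intermediate subring is maximal).  Then there is a sequence `R : ℕ → Subring K`, `R 0 = R₀`, of quadratic
transforms along `O`, all regular local rings of dimension `dim R₀`, each of the form `locAtCentre A' O` for a finitely
generated `A ≤ A' ⊆ O`. [folklore] -/
theorem exists_quadraticSeq_package (A : Subalgebra k K) (O : ValuationSubring K) (hAO : A.toSubring ≤ O.toSubring)
    (hAfg : A.FG) [IsFractionRing A K] (hreg : IsRegularLocalRing (locAtCentre A.toSubring O))
    (hd : ringKrullDim (locAtCentre A.toSubring O) ≠ 0)
    (hzd : ∀ (T : Subring K) (hT : T ≤ O.toSubring), A.toSubring ≤ T → (subringCentre T O hT).IsMaximal) :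
    ∃ R : ℕ → Subring K, R 0 = locAtCentre A.toSubring O ∧
      (∀ i, IsQuadraticTransformAlong O (R i) (R (i + 1))) ∧
      (∀ i, IsRegularLocalRing (R i)) ∧
      (∀ i, ringKrullDim (R i) = ringKrullDim (locAtCentre A.toSubring O)) ∧
      (∀ i, ∃ A' : Subalgebra k K, A'.toSubring ≤ O.toSubring ∧ A ≤ A' ∧ A'.FG ∧ R i = locAtCentre A'.toSubring O) := by
  classical
  -- dimension of the local rings of models
  have hdimT : ∀ A' : Subalgebra k K, (hA'O : A'.toSubring ≤ O.toSubring) → A ≤ A' → A'.FG →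
      ringKrullDim (locAtCentre A'.toSubring O) = ringKrullDim (locAtCentre A.toSubring O) := by
    intro A' hA'O hAA' hA'fg
    rw [ringKrullDim_locAtCentre_eq_of_isMaximal A' hA'fg O hA'O (hzd A'.toSubring hA'O fun x hx => hAA' hx),
      ringKrullDim_locAtCentre_eq_of_isMaximal A hAfg O hAO (hzd A.toSubring hAO le_rfl),
      ringKrullDim_eq_of_fg_of_le hAfg hA'fg hAA']
  let R : ℕ → Subring K := quadraticSeq O (locAtCentre A.toSubring O)
  -- the invariant
  have inv : ∀ i, IsRegularLocalRing (R i) ∧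
      (∃ A' : Subalgebra k K, A'.toSubring ≤ O.toSubring ∧ A ≤ A' ∧ A'.FG ∧ R i = locAtCentre A'.toSubring O) ∧
      IsQuadraticTransformAlong O (R i) (R (i + 1)) := by
    intro i
    induction i with
    | zero =>
      have hR0 : R 0 = locAtCentre A.toSubring O := rfl
      have hmodel : ∃ A' : Subalgebra k K, A'.toSubring ≤ O.toSubring ∧ A ≤ A' ∧ A'.FG ∧
          R 0 = locAtCentre A'.toSubring O := ⟨A, hAO, le_rfl, hAfg, hR0⟩
      haveI : IsRegularLocalRing (R 0) := by rw [hR0]; exact hreg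
      have hne : maximalIdeal (R 0) ≠ ⊥ := by
        intro hbot
        have hfield : IsField (R 0) := IsLocalRing.isField_iff_maximalIdeal_eq.mpr hbot
        have h0 : ringKrullDim (R 0) = 0 := ringKrullDim_eq_zero_of_isField hfield
        exact hd (hR0 ▸ h0)
      have hstep : IsQuadraticTransformAlong O (R 0) (R 1) :=
        quadraticSeq_succ_of_exists (exists_isQuadraticTransformAlong (B := R 0) (hR0 ▸ locAtCentre_le hAO) hne)
      exact ⟨‹_›, hmodel, hstep⟩
    | succ i ih =>
      obtain ⟨hregi, ⟨A₁, hA₁O, hAA₁, hA₁fg, hRi⟩, hstepi⟩ := ih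
      have hreg1 : IsRegularLocalRing (R (i + 1)) := hstepi.isRegularLocalRing_of_isRegularLocalRing hregi
      have hlb : IsLocalBlowup O (locAtCentre A₁.toSubring O) (R (i + 1)) := hRi ▸ hstepi.isLocalBlowup
      obtain ⟨A', hA'O, hAA', hA'fg, hR1⟩ := exists_model_of_isLocalBlowup hAA₁ hA₁fg hlb
      haveI := hreg1
      have hne : maximalIdeal (R (i + 1)) ≠ ⊥ := by
        intro hbot
        have hfield : IsField (R (i + 1)) := IsLocalRing.isField_iff_maximalIdeal_eq.mpr hbot
        have h0 : ringKrullDim (R (i + 1)) = 0 := ringKrullDim_eq_zero_of_isField hfield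
        rw [hR1, hdimT A' hA'O hAA' hA'fg] at h0
        exact hd h0
      have hstep : IsQuadraticTransformAlong O (R (i + 1)) (R (i + 1 + 1)) :=
        quadraticSeq_succ_of_exists (exists_isQuadraticTransformAlong (B := R (i + 1)) hstepi.target_le hne)
      exact ⟨hreg1, ⟨A', hA'O, hAA', hA'fg, hR1⟩, hstep⟩
  refine ⟨R, rfl, fun i => (inv i).2.2, fun i => (inv i).1, fun i => ?_, fun i => (inv i).2.1⟩
  obtain ⟨A', hA'O, hAA', hA'fg, hRi⟩ := (inv i).2.1
  rw [hRi]
  exact hdimT A' hA'O hAA' hA'fg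

/-! ## Transport of a derivation along the sequence -/

/-- **Transport of a derivation along the quadratic sequence.** If `s • D` (`s ≠ 0`) maps `R 0` into itself, then at
every stage some nonzero multiple `sᵢ • D` maps `R i` into itself. [folklore] -/
theorem exists_derivation_preserving_seq {O : ValuationSubring K} (R : ℕ → Subring K)
    (hstep : ∀ i, IsQuadraticTransformAlong O (R i) (R (i + 1))) (D : Derivation ℤ K K) (s : K) (hs : s ≠ 0)
    (hD : ∀ y ∈ R 0, s * D y ∈ R 0) :
    ∀ i, ∃ sᵢ : K, sᵢ ≠ 0 ∧ ∀ y ∈ R i, sᵢ * D y ∈ R i := by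
  intro i
  induction i with
  | zero => exact ⟨s, hs, hD⟩
  | succ i ih =>
    obtain ⟨sᵢ, hsᵢ, hDi⟩ := ih
    obtain ⟨_, x, -, hx0, -, hR1⟩ := (hstep i).exists_eq_locAtCentre
    have hx0' : (x : K) ≠ 0 := fun h0 => hx0 (Subtype.ext h0)
    refine ⟨(x : K) * sᵢ, mul_ne_zero hx0' hsᵢ, ?_⟩
    -- `sᵢ • D` as a derivation preserving `R i`
    let E : Derivation ℤ K K := sᵢ • D
    have hE : ∀ y, E y = sᵢ * D y := fun y => by simp [E, smul_eq_mul]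
    have hEi : ∀ y ∈ R i, E y ∈ R i := fun y hy => by rw [hE]; exact hDi y hy
    have hB := mul_derivation_mem_blowupRing E hEi x.2 hx0'
    have hL := mul_derivation_mem_locAtCentre E (x : K) (B := blowupRing (R i) (x : K)) (O := O) hB
    intro y hy
    rw [hR1] at hy
    have := hL y hy
    rw [hE, ← mul_assoc] at this
    rw [hR1]
    exact this

end Summit.ResolutionOfSingularities.ResolutionOfSingularities.Theorems.RadicialJung.CleanModels

end
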